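import Summits.SmoothPoincare4.SmoothPoincare4.Theorems.SullivanDualTarget

/-!
# SmoothPoincare4 / SullivanDual — crux `Target` (stmt-SmoothPoincare4-7823), line `Sketch`:
# closed taming kills witnesses, given a local primitive (stub
# `helper_closedTamingKillsWitnessesOfPrimitive`)

The CLOSED-form version of `SullivanDual.closedExactTamingKillsWitnesses`: let `J` on `M ∖ p`
be standard on the punctured `ε'`-chart-ball (closed `ε'`-ball inside the chart target), let
`sf` be a smooth closed `2`-form with `sf_x(v, J v) > 0` for all `v ≠ 0`, everywhere, and let
`γ` be a smooth `1`-form with `dγ = sf` on the punctured `ε`-chart-ball (`0 < ε < ε'`).  Then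
`J` has no taming witness at radius `ε`.

Proof.  As in the exact case (`stub_ctkwOfInputs`): at radii `ε < ε₃ < ε₄ < ε'` the four
analytic stubs (`stub_omegaFlat`, `stub_invChartMap`, `stub_cutoff`, `stub_formBound`) give the
collar form `ω̃` (`exists_collarForm`) and the collar lemma `stub_collar` (with `sf` as the
taming form); with the cut-off `φ` (`= 0` on `B_ε`, `= 1` near every point off `B_{ε₃}`),
`dγ = d(φγ) + d((1-φ)γ)`, (W2) kills `T d(φγ)` and the collar lemma kills `T d((1-φ)γ)`, so
`T dγ = 0`.  The one extra step: `sf - dγ` is smooth, closed (`d sf = 0`, `ddγ = 0`) and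
vanishes on `B_ε`, so (W2) gives `T (sf - dγ) = 0`; hence `T sf = 0`, contradicting (W1).

References: D. Sullivan, Invent. Math. 36 (1976), Thm. I.7 [Sullivan1976]; M. Gromov, Invent.
Math. 82 (1985), §0.3.C [Gromov1985].
-/

noncomputable section

-- the registered namespace `Summit.SmoothPoincare4.SmoothPoincare4.Theorems` repeats a component
set_option linter.dupNamespace false

open scoped Manifold ContDiff Topology InnerProductSpace
open Set Filter Metric
open Literature.Geometry.Kaehler Literature.Geometry.Symplectic

namespace Summit.SmoothPoincare4.SmoothPoincare4.Theorems

namespace SullivanDual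

/-- **Closed taming kills witnesses, given a local primitive.** Let `J` on `M ∖ p` be standard
on the punctured `ε'`-chart-ball (closed `ε'`-ball inside the chart target), `0 < ε < ε'`, let
`sf` be a smooth closed `2`-form with `sf_x(v, J v) > 0` for all `v ≠ 0` everywhere, and let
`γ` be a smooth `1`-form with `dγ = sf` on the punctured `ε`-ball. Then `J` has no taming
witness at radius `ε`: `T dγ = 0` by the split `dγ = d(φγ) + d((1-φ)γ)` ((W2) and the collar
lemma), and `T (sf - dγ) = 0` by (W2), contradicting `T sf > 0` ((W1)).
[cite: Sullivan1976, Thm. I.7] -/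
theorem helper_closedTamingKillsWitnessesOfPrimitive
    {M : Type*} [TopologicalSpace M] [T2Space M] [ChartedSpace (EuclideanSpace ℝ (Fin 4)) M]
    [IsManifold (𝓡 4) ∞ M] (p : M)
    (J : ∀ x : punctured p, TangentSpace (𝓡 4) x →L[ℝ] TangentSpace (𝓡 4) x) {ε ε' : ℝ}
    (hε : 0 < ε) (hεε' : ε < ε')
    (hball : Metric.closedBall (extChartAt (𝓡 4) p p) ε' ⊆ (extChartAt (𝓡 4) p).target)
    (hstd : ∀ x : punctured p, InPuncturedChartBall p ε' x →
        ∀ (v : TangentSpace (𝓡 4) x) (b : EuclideanSpace ℝ (Fin 4)),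
        inner ℝ (fderiv ℝ inversion (extChartAt (𝓡 4) p x.1 - extChartAt (𝓡 4) p p)
          (mfderiv (𝓡 4) 𝓘(ℝ, EuclideanSpace ℝ (Fin 4))
            (fun z : punctured p => extChartAt (𝓡 4) p z.1) x (J x v))) b =
        stdSymplecticForm (fderiv ℝ inversion (extChartAt (𝓡 4) p x.1 - extChartAt (𝓡 4) p p)
          (mfderiv (𝓡 4) 𝓘(ℝ, EuclideanSpace ℝ (Fin 4))
            (fun z : punctured p => extChartAt (𝓡 4) p z.1) x v)) b)
    {sf : MForm (𝓡 4) (punctured p) ℝ 2} (hsf : IsSmoothForm sf) (hsfc : IsClosedForm sf)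
    (htame : ∀ (x : punctured p) (v : TangentSpace (𝓡 4) x), v ≠ 0 → 0 < sf x ![v, J x v])
    {γ : MForm (𝓡 4) (punctured p) ℝ 1} (hγ : IsSmoothForm γ)
    (hγsf : ∀ x : punctured p, InPuncturedChartBall p ε x → mextDeriv γ x = sf x) :
    NoWitness p ε J := by
  intro T hT
  -- radii `ε < ε₃ < ε₄ < ε'`
  obtain ⟨ε₃, hε₃, hε₃'⟩ : ∃ ε₃, ε < ε₃ ∧ ε₃ < ε' := exists_between hεε'
  obtain ⟨ε₄, hε₄, hε₄'⟩ : ∃ ε₄, ε₃ < ε₄ ∧ ε₄ < ε' := exists_between hε₃'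
  have hε₃pos : 0 < ε₃ := hε.trans hε₃
  have hε₄pos : 0 < ε₄ := hε₃pos.trans hε₄
  -- (A) the flat collar form, in inverted coordinates `R₄ = ε₄⁻¹ < R₃ = ε₃⁻¹ < R = ε⁻¹`
  obtain ⟨Ω, hΩs, hΩc, hΩ0, hΩstd, hΩnn, c, hc, hΩpos⟩ :=
    stub_omegaFlat ε₄⁻¹ ε₃⁻¹ ε⁻¹ (inv_pos.2 hε₄pos) ((inv_lt_inv₀ hε₄pos hε₃pos).2 hε₄)
      ((inv_lt_inv₀ hε₃pos hε).2 hε₃)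
  -- (B) the cut-off inverted chart with radius `ε'`
  obtain ⟨Φ, hΦs, hΦeq, hΦle⟩ := stub_invChartMap p ε' (hε.trans hεε') hball
  -- (D) the cut-off for the split `γ = φγ + (1-φ)γ` (`φ = 0` on `B_ε`, `= 1` near `M ∖ B_{ε₃}`)
  obtain ⟨φ, hφs, hφ0, hφ1, -⟩ := stub_cutoff p ε ε₃ hε hε₃
    ((Metric.closedBall_subset_closedBall hε₃'.le).trans hball)
  -- (C) chart-norm bounds of smooth forms on the compact collar `ε ≤ ‖e x - e p‖ ≤ ε₃`
  have hbound := fun (α : MForm (𝓡 4) (punctured p) ℝ 2) (hα : IsSmoothForm α) =>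
    stub_formBound p α hα ε ε₃ hε hε₃.le
      ((Metric.closedBall_subset_closedBall hε₃'.le).trans hball)
  have hd : inChart_mextDeriv (𝓡 4) (punctured p) ℝ := inChart_mextDeriv_holds _ _ _
  -- the closed taming form and (W1)
  have hsft : TamesOffBall p ε J sf := fun x _ v hv => htame x v hv
  have hpos : 0 < T sf := hT.pos_of_tames hsf hsft
  -- the collar form and the collar lemma
  obtain ⟨ω', hω's, hω'c, hω'std, hω'nn, hω'pos⟩ :=
    exists_collarForm p J hε hε₃ hε₄ hε₄' hstd hΩs hΩc hΩ0 hΩstd hΩnn hΩpos hΦs hΦeq hΦle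
  have hcollar : ∀ α : MForm (𝓡 4) (punctured p) ℝ 2, IsSmoothForm α →
      (∀ x : punctured p, ¬ InPuncturedChartBall p ε₃ x → α x = 0) → T α = 0 :=
    fun α hα hα0 => stub_collar p J hε hε₃ (hε₄.trans hε₄') hstd hT hsf hsft hω's hω'c hω'std
      hω'nn hc hω'pos hbound hα hα0
  -- the split `γ = φγ + (1 - φ)γ`
  have hφs' : ContMDiff (𝓡 4) 𝓘(ℝ, ℝ) ∞ (fun x => 1 - φ x) := contMDiff_const.sub hφs
  have hγ₁s : IsSmoothForm (φ • γ) := hγ.fun_smul' hφs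
  have hγ₂s : IsSmoothForm ((fun x => 1 - φ x) • γ) := hγ.fun_smul' hφs'
  have hsplit : γ = φ • γ + (fun x => 1 - φ x) • γ := by
    funext x
    simp only [Pi.add_apply, Pi.smul_apply']
    rw [← add_smul]
    simp
  have hdsplit : mextDeriv γ = mextDeriv (φ • γ) + mextDeriv ((fun x => 1 - φ x) • γ) := by
    conv_lhs => rw [hsplit]
    exact mextDeriv_add hγ₁s hγ₂s
  -- (W2) kills `d(φγ)`: closed, smooth, and `φγ ≡ 0` on the open ball `B_ε`
  have h1 : T (mextDeriv (φ • γ)) = 0 := by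
    refine hT.eq_zero_of_vanishes (isSmoothForm_mextDeriv hd hγ₁s) (mextDeriv_mextDeriv hd hγ₁s)
      fun x hx => ?_
    have hev : ∀ᶠ z in 𝓝 x, (φ • γ) z = (0 : MForm (𝓡 4) (punctured p) ℝ 1) z := by
      filter_upwards [(isOpen_setOf_inPuncturedChartBall p ε).mem_nhds hx] with z hz
      simp only [Pi.smul_apply', hφ0 z hz, zero_smul, Pi.zero_apply]
    rw [mextDeriv_congr_of_eventuallyEq hev, mextDeriv_zero]
    rfl
  -- the collar lemma kills `d((1-φ)γ)`: smooth and `≡ 0` near every point off `B_{ε₃}`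
  have h2 : T (mextDeriv ((fun x => 1 - φ x) • γ)) = 0 := by
    refine hcollar _ (isSmoothForm_mextDeriv hd hγ₂s) fun x hx => ?_
    have hev : ∀ᶠ z in 𝓝 x,
        ((fun x => 1 - φ x) • γ) z = (0 : MForm (𝓡 4) (punctured p) ℝ 1) z := by
      filter_upwards [hφ1 x hx] with z hz
      simp only [Pi.smul_apply', hz, sub_self, zero_smul, Pi.zero_apply]
    rw [mextDeriv_congr_of_eventuallyEq hev, mextDeriv_zero]
    rfl
  have hdγ : T (mextDeriv γ) = 0 := by
    rw [hdsplit, map_add, h1, h2, add_zero]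
  -- NEW: (W2) kills `sf - dγ`: smooth, closed (`d sf = 0`, `ddγ = 0`), `= 0` on `B_ε`
  have hdγs : IsSmoothForm (mextDeriv γ) := isSmoothForm_mextDeriv hd hγ
  have hδs : IsSmoothForm (sf + (-1 : ℝ) • mextDeriv γ) := hsf.add (hdγs.smul (-1))
  have hδc : IsClosedForm (sf + (-1 : ℝ) • mextDeriv γ) := by
    show mextDeriv (sf + (-1 : ℝ) • mextDeriv γ) = 0
    rw [mextDeriv_add hsf (hdγs.smul (-1)), mextDeriv_smul, mextDeriv_mextDeriv hd hγ,
      smul_zero, add_zero]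
    exact hsfc
  have h0 : T (sf + (-1 : ℝ) • mextDeriv γ) = 0 := by
    refine hT.eq_zero_of_vanishes hδs hδc fun x hx => ?_
    simp only [Pi.add_apply, Pi.smul_apply, hγsf x hx]
    simp
  rw [map_add, map_smul, hdγ, smul_zero, add_zero] at h0
  rw [h0] at hpos
  exact lt_irrefl 0 hpos

end SullivanDual

end Summit.SmoothPoincare4.SmoothPoincare4.Theorems

end
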